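import Literature.Analysis.FunctionSpaces.TorusPlanarLift
import Literature.Analysis.FunctionSpaces.TorusCalculusProofs
import Literature.Analysis.FunctionSpaces.TorusTestFunction
import Literature.Analysis.FunctionSpaces.TorusSpaceTime
import Literature.Analysis.FunctionSpaces.SmoothParametricIntegral
import Literature.Analysis.FunctionSpaces.MinkowskiIntegral
import HarnessLib

/-!
# Calculus of axis averages on the flat torus, and planar sections `T² → T³`

Analysis/FunctionSpaces support file (all proved). The axis average
`Torus.axisAvg i v x = ∫ v (x + s eᵢ) ds` of `Literature/Analysis/FunctionSpaces/TorusAxisAverage`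
is the device that reduces a three-dimensional test field to a "two-and-a-half-dimensional"
one when a weak formulation is paired against a field that does not depend on one coordinate —
the bookkeeping behind the statement "the triple `(u₁(x₁,x₂,t), u₂(x₁,x₂,t), w(x₁,x₂,t))` will be a
weak solution of the 3D Euler equations … if `w` is a weak solution of the 2D transport equation"
(Bardos–Titi–Wiedemann, C. R. Math. 350 (2012), proof of Cor. 2; Majda–Bertozzi 2002, §2.3.1,
two-and-a-half-dimensional flows). This file supplies:

* **smoothness and commutation with derivatives** (any dimension `d`, any axis `i`): the lift of
  the axis average is a parametric integral over `[0,1]` of translates of the lift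
  (`lift_axisAvg`, `stLift_axisAvg`), hence axis averages of smooth (space–time) fields are smooth
  (`IsSmooth.axisAvg`, `contDiff_stLift_axisAvg`, `IsSpaceTimeTest.axisAvg`) and the torus
  derivative, partial derivatives, divergence, gradient and time derivative commute with the
  average (`fderiv_axisAvg_apply`, `partialDeriv_axisAvg`, `divergence_axisAvg`, `gradient_axisAvg`,
  `timeDeriv_axisAvg`) — differentiation under the integral sign,
  `Literature.Analysis.FunctionSpaces.fderiv_parametric_intervalIntegral_apply`;
* **the pairing identity** `∫ ⟪A, B⟫ = ∫ ⟪A, axisAvg i B⟫` for a field `A` invariant under the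
  translations along the `i`-th axis (`integral_inner_eq_integral_inner_axisAvg`; Fubini through
  the measure-preserving shear `(x, s) ↦ x + s eᵢ` and translation invariance), with the two
  integrability providers used in practice (`A ∈ L¹`, `B` bounded; `A, B ∈ L²`);
* **`L²` contractivity** of the axis average (`eLpNorm_axisAvg_le`, Minkowski's integral
  inequality `Literature.Analysis.FunctionSpaces.eLpNorm_integral_le_lintegral_eLpNorm`);
* for `T³`: the **planar section** `Torus.planarSect : T² → T³`, `y ↦ (y₀, y₁, 0)`, the
  **planar shear** `Torus.planarShear : T² × T¹ → T³` (measure preserving,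
  `measurePreserving_planarShear`), and the descent of fields invariant along the third axis to
  planar lifts (`eq_comp_planarSect_comp_planarProj`, `eq_twoHalf_of_forall_add_single`), with
  measurability and the `L²` bound of the planar section of the third-axis average
  (`aestronglyMeasurable_axisAvg_comp_planarSect`, `eLpNorm_axisAvg_comp_planarSect_le`).

## Mathlib search

Mathlib has differentiation under the integral sign
(`hasFDerivAt_integral_of_dominated_of_fderiv_le`) and the circle/interval integral identity
`AddCircle.intervalIntegral_preimage`; no axis averages, no calculus on `UnitAddTorus`
(searched `axisAvg`, `UnitAddTorus.*fderiv`: none).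

## References

* C. Bardos, E. S. Titi, E. Wiedemann, C. R. Math. Acad. Sci. Paris 350 (2012) 757–760, proof of
  Cor. 2 (`BardosTitiWiedemann2012`).
* A. J. Majda, A. L. Bertozzi, *Vorticity and Incompressible Flow* (CUP 2002), §2.3.1.
* E. M. Stein, *Singular Integrals and Differentiability Properties of Functions* (1970), App. A.1
  (Minkowski's integral inequality).
-/

open MeasureTheory Set Filter Topology UnitAddTorus Function intervalIntegral
open scoped ENNReal NNReal InnerProductSpace ContDiff

noncomputable section

namespace Literature.Analysis.FunctionSpaces.Torus

/-! ## Axis averages as parametric integrals over `[0, 1]`; smoothness; derivatives -/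

section General

variable {d : Type*} [Fintype d] [DecidableEq d]
variable {F : Type*} [NormedAddCommGroup F] [NormedSpace ℝ F]

omit [Fintype d] in
/-- `proj (σ eᵢ) = (σ mod 1) eᵢ` on `T^d`. [folklore] -/
theorem proj_smul_single (σ : ℝ) (i : d) :
    proj (σ • EuclideanSpace.single i (1 : ℝ)) = (Pi.single i (σ : UnitAddCircle) : UnitAddTorus d) := by
  funext j
  rw [proj_smul_apply, PiLp.single_apply]
  by_cases h : j = i
  · subst h; simp
  · simp [h]

omit [NormedSpace ℝ F] in
/-- The Haar integral over `UnitAddCircle` as an interval integral over a period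
(Mathlib `AddCircle.intervalIntegral_preimage`). [folklore] -/
theorem integral_unitAddCircle_eq_intervalIntegral [NormedSpace ℝ F] [CompleteSpace F]
    (g : UnitAddCircle → F) : ∫ s, g s = ∫ σ in (0 : ℝ)..1, g (σ : UnitAddCircle) := by
  have h := AddCircle.intervalIntegral_preimage (1 : ℝ) 0 g
  rw [zero_add] at h
  exact h.symm

omit [Fintype d] in
/-- **The lift of an axis average is a parametric interval integral of translates of the lift**:
`lift (axisAvg i v) Y = ∫₀¹ lift v (Y + σ eᵢ) dσ`. [folklore] -/
theorem lift_axisAvg [CompleteSpace F] (i : d) (v : UnitAddTorus d → F) (Y : EuclideanSpace ℝ d) :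
    lift (axisAvg i v) Y = ∫ σ in (0 : ℝ)..1, lift v (Y + σ • EuclideanSpace.single i (1 : ℝ)) := by
  rw [lift_apply, axisAvg_apply, integral_unitAddCircle_eq_intervalIntegral]
  refine intervalIntegral.integral_congr fun σ _ => ?_
  simp only [lift_apply, proj_add, proj_smul_single]

/-- The spatial affine reparametrisation `(σ, Y) ↦ Y + σ eᵢ` and its derivative. [folklore] -/
theorem hasFDerivAt_spaceShift (i : d) (z : ℝ × EuclideanSpace ℝ d) :
    HasFDerivAt (fun z : ℝ × EuclideanSpace ℝ d => z.2 + z.1 • EuclideanSpace.single i (1 : ℝ))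
      (ContinuousLinearMap.snd ℝ ℝ (EuclideanSpace ℝ d) +
        (ContinuousLinearMap.fst ℝ ℝ (EuclideanSpace ℝ d)).smulRight (EuclideanSpace.single i (1 : ℝ))) z :=
  hasFDerivAt_snd.add (hasFDerivAt_fst.smul_const _)

/-- **Axis averages of smooth fields are smooth** (smooth dependence of interval integrals on
parameters, `Literature.Analysis.FunctionSpaces.contDiff_parametric_intervalIntegral`). [folklore] -/
theorem IsSmooth.axisAvg [CompleteSpace F] {v : UnitAddTorus d → F} (hv : IsSmooth v) (i : d) :
    IsSmooth (axisAvg i v) := by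
  have h : lift (Torus.axisAvg i v) = fun Y : EuclideanSpace ℝ d =>
      ∫ σ in (0 : ℝ)..1, (lift v ∘ fun z : ℝ × EuclideanSpace ℝ d =>
        z.2 + z.1 • EuclideanSpace.single i (1 : ℝ)) (σ, Y) := by
    funext Y
    rw [lift_axisAvg]
    rfl
  unfold IsSmooth
  rw [h]
  exact contDiff_parametric_intervalIntegral
    (hv.comp (contDiff_snd.add (contDiff_fst.smul contDiff_const))) 0 1

/-- **The torus derivative commutes with the axis average**: for smooth `v`,
`D(axisAvg i v)(x) w = axisAvg i (y ↦ Dv(y) w) x` (differentiation under the integral sign). [folklore] -/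
theorem fderiv_axisAvg_apply [CompleteSpace F] {v : UnitAddTorus d → F} (hv : IsSmooth v) (i : d)
    (x : UnitAddTorus d) (w : EuclideanSpace ℝ d) :
    Torus.fderiv (axisAvg i v) x w = axisAvg i (fun y => Torus.fderiv v y w) x := by
  obtain ⟨Y, rfl⟩ := proj_surjective x
  set H : ℝ × EuclideanSpace ℝ d → F := lift v ∘ fun z : ℝ × EuclideanSpace ℝ d =>
      z.2 + z.1 • EuclideanSpace.single i (1 : ℝ) with hH_def
  have hH : ContDiff ℝ ∞ H := hv.comp (contDiff_snd.add (contDiff_fst.smul contDiff_const))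
  have h : lift (axisAvg i v) = fun Y : EuclideanSpace ℝ d => ∫ σ in (0 : ℝ)..1, H (σ, Y) := by
    funext Y
    rw [lift_axisAvg]
    rfl
  have hinf : (∞ : WithTop ℕ∞) ≠ 0 := by exact_mod_cast WithTop.coe_ne_zero.2 (by decide)
  rw [← fderiv_lift, h, fderiv_parametric_intervalIntegral_apply hH hinf 0 1 Y w]
  rw [← lift_apply (axisAvg i fun y => Torus.fderiv v y w), lift_axisAvg]
  refine intervalIntegral.integral_congr fun σ _ => ?_
  have hd : DifferentiableAt ℝ (lift v) (Y + σ • EuclideanSpace.single i (1 : ℝ)) :=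
    (hv.differentiable hinf) _
  have hc := hd.hasFDerivAt.comp ((σ, Y) : ℝ × EuclideanSpace ℝ d) (hasFDerivAt_spaceShift i (σ, Y))
  simp only [hH_def]
  rw [hc.fderiv, lift_apply, ← fderiv_lift]
  simp

/-- **Partial derivatives commute with the axis average** (smooth fields). [folklore] -/
theorem partialDeriv_axisAvg [CompleteSpace F] {v : UnitAddTorus d → F} (hv : IsSmooth v) (i j : d) :
    partialDeriv j (axisAvg i v) = axisAvg i (partialDeriv j v) := by
  funext x
  rw [partialDeriv_eq_fderiv_apply ((hv.axisAvg i).isContDiff (by simp)), fderiv_axisAvg_apply hv]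
  congr 1
  funext y
  rw [partialDeriv_eq_fderiv_apply (hv.isContDiff (by simp))]

/-- Coordinates commute with the axis average (continuous fields). [folklore] -/
theorem axisAvg_apply_coord {v : UnitAddTorus d → EuclideanSpace ℝ d} (hv : Continuous v) (i j : d)
    (x : UnitAddTorus d) : axisAvg i v x j = axisAvg i (fun y => v y j) x := by
  rw [axisAvg_apply, axisAvg_apply]
  have hint : Integrable (fun s : UnitAddCircle => v (x + Pi.single i s)) volume :=
    (hv.comp (continuous_const.add (continuous_single i))).integrable_of_hasCompactSupport
      (HasCompactSupport.of_compactSpace _)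
  exact ((EuclideanSpace.proj j : EuclideanSpace ℝ d →L[ℝ] ℝ).integral_comp_comm hint).symm

/-- **The divergence commutes with the axis average** (smooth fields). [folklore] -/
theorem divergence_axisAvg {v : UnitAddTorus d → EuclideanSpace ℝ d} (hv : IsSmooth v) (i : d) :
    divergence (axisAvg i v) = axisAvg i (divergence v) := by
  funext x
  rw [divergence, axisAvg_apply]
  have hcoord : ∀ j : d, (fun y => axisAvg i v y j) = axisAvg i (fun y => v y j) := fun j =>
    funext fun y => axisAvg_apply_coord hv.continuous i j y
  have hterm : ∀ j : d, partialDeriv j (fun y => axisAvg i v y j) x =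
      ∫ s : UnitAddCircle, partialDeriv j (fun y => v y j) (x + Pi.single i s) := by
    intro j
    rw [hcoord j, partialDeriv_axisAvg (hv.apply j) i j, axisAvg_apply]
  simp_rw [hterm]
  rw [← MeasureTheory.integral_finsetSum]
  · rfl
  · intro j _
    exact (((hv.apply j).partialDeriv j).continuous.comp
      (continuous_const.add (continuous_single i))).integrable_of_hasCompactSupport
      (HasCompactSupport.of_compactSpace _)

/-- Divergence-free smooth fields have divergence-free axis averages. [folklore] -/
theorem IsDivFree.axisAvg {v : UnitAddTorus d → EuclideanSpace ℝ d} (hv : IsSmooth v)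
    (h : IsDivFree v) (i : d) : IsDivFree (axisAvg i v) := by
  intro x
  rw [divergence_axisAvg hv, axisAvg_apply]
  simp [h _]

/-- **The gradient commutes with the axis average** (smooth scalars): `∇(axisAvg i θ) = axisAvg i (∇θ)`
(both sides represent `w ↦ axisAvg i (y ↦ Dθ(y) w)`). [folklore] -/
theorem gradient_axisAvg {θ : UnitAddTorus d → ℝ} (hθ : IsSmooth θ) (i : d) :
    gradient (axisAvg i θ) = axisAvg i (gradient θ) := by
  funext x
  refine ext_inner_right ℝ fun w => ?_
  have hint : Integrable (fun s : UnitAddCircle => Torus.gradient θ (x + Pi.single i s)) volume :=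
    (hθ.gradient.continuous.comp (continuous_const.add (continuous_single i))).integrable_of_hasCompactSupport
      (HasCompactSupport.of_compactSpace _)
  rw [inner_gradient_left, fderiv_axisAvg_apply hθ, axisAvg_apply, axisAvg_apply, real_inner_comm,
    ← integral_inner hint w]
  simp_rw [real_inner_comm _ w, inner_gradient_left]

omit [Fintype d] in
/-- The axis average of the zero field vanishes. [folklore] -/
theorem axisAvg_zero (i : d) : axisAvg i (0 : UnitAddTorus d → F) = 0 := by
  funext x
  simp [axisAvg_apply]

/-! ### Space–time fields -/

omit [Fintype d] in
/-- Space–time form of `lift_axisAvg`: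
`stLift (t ↦ axisAvg i (ψ t)) (t, Y) = ∫₀¹ stLift ψ (t, Y + σ eᵢ) dσ`. [folklore] -/
theorem stLift_axisAvg [CompleteSpace F] (i : d) (ψ : ℝ → UnitAddTorus d → F)
    (p : ℝ × EuclideanSpace ℝ d) :
    stLift (fun t => axisAvg i (ψ t)) p =
      ∫ σ in (0 : ℝ)..1, stLift ψ (p.1, p.2 + σ • EuclideanSpace.single i (1 : ℝ)) := by
  have h := lift_axisAvg i (ψ p.1) p.2
  rw [lift_apply] at h
  rw [stLift_apply, h]
  rfl

/-- The space–time affine reparametrisation `(σ, (t, Y)) ↦ (t, Y + σ eᵢ)` and its derivative. [folklore] -/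
theorem hasFDerivAt_axisShift (i : d) (z : ℝ × (ℝ × EuclideanSpace ℝ d)) :
    HasFDerivAt (fun z : ℝ × (ℝ × EuclideanSpace ℝ d) => (z.2.1, z.2.2 + z.1 • EuclideanSpace.single i (1 : ℝ)))
      (((ContinuousLinearMap.fst ℝ ℝ (EuclideanSpace ℝ d)).comp (ContinuousLinearMap.snd ℝ ℝ (ℝ × EuclideanSpace ℝ d))).prod
        (((ContinuousLinearMap.snd ℝ ℝ (EuclideanSpace ℝ d)).comp (ContinuousLinearMap.snd ℝ ℝ (ℝ × EuclideanSpace ℝ d))) +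
          (ContinuousLinearMap.fst ℝ ℝ (ℝ × EuclideanSpace ℝ d)).smulRight (EuclideanSpace.single i (1 : ℝ)))) z := by
  refine (hasFDerivAt_snd.fst).prodMk ?_
  exact (hasFDerivAt_snd.snd).add (hasFDerivAt_fst.smul_const _)

/-- **Jointly smooth space–time fields have jointly smooth axis averages.** [folklore] -/
theorem contDiff_stLift_axisAvg [CompleteSpace F] {ψ : ℝ → UnitAddTorus d → F}
    (hψ : ContDiff ℝ ∞ (stLift ψ)) (i : d) :
    ContDiff ℝ ∞ (stLift fun t => axisAvg i (ψ t)) := by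
  have h : stLift (fun t => axisAvg i (ψ t)) = fun p : ℝ × EuclideanSpace ℝ d =>
      ∫ σ in (0 : ℝ)..1, (stLift ψ ∘ fun z : ℝ × (ℝ × EuclideanSpace ℝ d) =>
        (z.2.1, z.2.2 + z.1 • EuclideanSpace.single i (1 : ℝ))) (σ, p) := by
    funext p
    rw [stLift_axisAvg]
    rfl
  rw [h]
  refine contDiff_parametric_intervalIntegral (hψ.comp ?_) 0 1
  exact (contDiff_fst.comp contDiff_snd).prodMk
    ((contDiff_snd.comp contDiff_snd).add (contDiff_fst.smul contDiff_const))

/-- Derivatives of the space–time lift of the axis average in any space–time direction: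
`D(stLift ψ̄)(p) q = ∫₀¹ D(stLift ψ)(p.1, p.2 + σ eᵢ) q dσ`. [folklore] -/
theorem fderiv_stLift_axisAvg_apply [CompleteSpace F] {ψ : ℝ → UnitAddTorus d → F}
    (hψ : ContDiff ℝ ∞ (stLift ψ)) (i : d) (p q : ℝ × EuclideanSpace ℝ d) :
    _root_.fderiv ℝ (stLift fun t => axisAvg i (ψ t)) p q =
      ∫ σ in (0 : ℝ)..1, _root_.fderiv ℝ (stLift ψ) (p.1, p.2 + σ • EuclideanSpace.single i (1 : ℝ)) q := by
  set H : ℝ × (ℝ × EuclideanSpace ℝ d) → F := stLift ψ ∘ fun z : ℝ × (ℝ × EuclideanSpace ℝ d) =>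
        (z.2.1, z.2.2 + z.1 • EuclideanSpace.single i (1 : ℝ)) with hH_def
  have hH : ContDiff ℝ ∞ H :=
    hψ.comp ((contDiff_fst.comp contDiff_snd).prodMk
      ((contDiff_snd.comp contDiff_snd).add (contDiff_fst.smul contDiff_const)))
  have h : stLift (fun t => axisAvg i (ψ t)) = fun p : ℝ × EuclideanSpace ℝ d =>
      ∫ σ in (0 : ℝ)..1, H (σ, p) := by
    funext p
    rw [stLift_axisAvg]
    rfl
  have hinf : (∞ : WithTop ℕ∞) ≠ 0 := by exact_mod_cast WithTop.coe_ne_zero.2 (by decide)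
  rw [h, fderiv_parametric_intervalIntegral_apply hH hinf 0 1 p q]
  refine intervalIntegral.integral_congr fun σ _ => ?_
  have hd : DifferentiableAt ℝ (stLift ψ) (p.1, p.2 + σ • EuclideanSpace.single i (1 : ℝ)) :=
    (hψ.differentiable hinf) _
  have hc := hd.hasFDerivAt.comp ((σ, p) : ℝ × (ℝ × EuclideanSpace ℝ d)) (hasFDerivAt_axisShift i (σ, p))
  simp only [hH_def]
  rw [hc.fderiv]
  simp

omit [DecidableEq d] in
/-- The partial time derivative is the full derivative in the direction `(1, 0)`. [folklore] -/
theorem fderiv_curry_time_apply_one {f : ℝ × EuclideanSpace ℝ d → F} {p : ℝ × EuclideanSpace ℝ d}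
    (hf : DifferentiableAt ℝ f p) :
    _root_.fderiv ℝ (fun τ => f (τ, p.2)) p.1 (1 : ℝ) = _root_.fderiv ℝ f p ((1 : ℝ), (0 : EuclideanSpace ℝ d)) := by
  have hg : HasFDerivAt (fun τ : ℝ => (τ, p.2)) (ContinuousLinearMap.inl ℝ ℝ (EuclideanSpace ℝ d)) p.1 :=
    hasFDerivAt_prodMk_left p.1 p.2
  have hc : HasFDerivAt (fun τ : ℝ => f (τ, p.2))
      ((_root_.fderiv ℝ f p).comp (ContinuousLinearMap.inl ℝ ℝ (EuclideanSpace ℝ d))) p.1 :=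
    hf.hasFDerivAt.comp p.1 hg
  rw [hc.fderiv]
  simp

omit [DecidableEq d] in
/-- The space–time lift of the time derivative of a field with differentiable lift:
`stLift (∂ₜψ) p = D(stLift ψ)(p) (1, 0)`. [folklore] -/
theorem stLift_timeDeriv_apply_of_differentiable {ψ : ℝ → UnitAddTorus d → F}
    (hψ : Differentiable ℝ (stLift ψ)) (p : ℝ × EuclideanSpace ℝ d) :
    stLift (timeDeriv ψ) p = _root_.fderiv ℝ (stLift ψ) p ((1 : ℝ), (0 : EuclideanSpace ℝ d)) := by
  rw [stLift_timeDeriv]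
  exact fderiv_curry_time_apply_one (hψ p)

/-- **Time derivatives commute with the axis average** (jointly smooth fields). [folklore] -/
theorem timeDeriv_axisAvg [CompleteSpace F] {ψ : ℝ → UnitAddTorus d → F}
    (hψ : ContDiff ℝ ∞ (stLift ψ)) (i : d) (t : ℝ) (x : UnitAddTorus d) :
    timeDeriv (fun t => axisAvg i (ψ t)) t x = axisAvg i (timeDeriv ψ t) x := by
  obtain ⟨Y, rfl⟩ := proj_surjective x
  have hinf : (∞ : WithTop ℕ∞) ≠ 0 := by exact_mod_cast WithTop.coe_ne_zero.2 (by decide)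
  have hd : Differentiable ℝ (stLift fun t => axisAvg i (ψ t)) :=
    (contDiff_stLift_axisAvg hψ i).differentiable hinf
  have h1 := stLift_timeDeriv_apply_of_differentiable hd (t, Y)
  rw [stLift_apply] at h1
  rw [h1, fderiv_stLift_axisAvg_apply hψ i (t, Y)]
  have h2 := stLift_axisAvg i (timeDeriv ψ) (t, Y)
  rw [stLift_apply] at h2
  rw [h2]
  refine intervalIntegral.integral_congr fun σ _ => ?_
  exact (stLift_timeDeriv_apply_of_differentiable (hψ.differentiable hinf) _).symm

/-- **Axis averages of space–time test fields are space–time test fields** (same support in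
time). [folklore] -/
theorem IsSpaceTimeTest.axisAvg [CompleteSpace F] {T : ℝ} {ψ : ℝ → UnitAddTorus d → F}
    (hψ : IsSpaceTimeTest T ψ) (i : d) : IsSpaceTimeTest T (fun t => axisAvg i (ψ t)) := by
  obtain ⟨hs, T', hT', h0⟩ := hψ
  refine ⟨contDiff_stLift_axisAvg hs i, T', hT', fun t ht => ?_⟩
  show Torus.axisAvg i (ψ t) = 0
  rw [h0 t ht, axisAvg_zero]

omit [DecidableEq d] in
/-- Slices `τ ↦ ψ τ x` of a field with smooth space–time lift are differentiable, with derivative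
the time derivative. [folklore] -/
theorem hasDerivAt_slice_timeDeriv {ψ : ℝ → UnitAddTorus d → F} (hψ : ContDiff ℝ ∞ (stLift ψ))
    (t : ℝ) (x : UnitAddTorus d) : HasDerivAt (fun τ => ψ τ x) (timeDeriv ψ t x) t := by
  have hinf : (∞ : WithTop ℕ∞) ≠ 0 := by exact_mod_cast WithTop.coe_ne_zero.2 (by decide)
  have h : (fun τ => ψ τ x) = stLift ψ ∘ fun τ => (τ, repr x) := by
    funext τ
    simp [stLift_apply, proj_repr]
  have hdiff : Differentiable ℝ (fun τ => ψ τ x) := by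
    rw [h]
    exact (hψ.differentiable hinf).comp (differentiable_id.prodMk (differentiable_const _))
  exact (hdiff t).hasDerivAt

end General

/-! ## Pairings with axis-invariant fields -/

section PairingSec

variable {d : Type*} [Fintype d] [DecidableEq d]
variable {G : Type*} [NormedAddCommGroup G] [InnerProductSpace ℝ G]

/-- **Pairing with an axis-invariant field only sees the axis average**: if
`A (x + s eᵢ) = A x` for all `s`, then `∫ ⟪A, B⟫ = ∫ ⟪A, axisAvg i B⟫` (change of variables along the
measure-preserving shear `(x, s) ↦ x + s eᵢ`, Fubini, translation invariance, and
`∫ ⟪a, f s⟫ ds = ⟪a, ∫ f⟫`). Hypotheses: `A` measurable, `B ∈ L¹`, and integrability of the sheared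
pairing on `T^d × T¹` (see the two providers below). [folklore] -/
theorem integral_inner_eq_integral_inner_axisAvg [CompleteSpace G] (i : d) {A B : UnitAddTorus d → G}
    (hA : ∀ (s : UnitAddCircle) (x : UnitAddTorus d), A (x + Pi.single i s) = A x)
    (hAm : AEStronglyMeasurable A volume) (hB : Integrable B volume)
    (hint : Integrable (fun p : UnitAddTorus d × UnitAddCircle => ⟪A p.1, B (p.1 + Pi.single i p.2)⟫_ℝ)
      ((volume : Measure (UnitAddTorus d)).prod (volume : Measure UnitAddCircle))) :
    ∫ x, ⟪A x, B x⟫_ℝ = ∫ x, ⟪A x, axisAvg i B x⟫_ℝ := by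
  have hmp := measurePreserving_add_single_prod i
  -- sections of `B` along the axis are integrable for a.e. `x`
  have hsec : ∀ᵐ x ∂(volume : Measure (UnitAddTorus d)),
      Integrable (fun s : UnitAddCircle => B (x + Pi.single i s)) volume :=
    ((hmp.integrable_comp hB.aestronglyMeasurable).2 hB).prod_right_ae
  have hABm : AEStronglyMeasurable (fun x => ⟪A x, B x⟫_ℝ) volume := hAm.inner hB.aestronglyMeasurable
  calc ∫ x, ⟪A x, B x⟫_ℝ
      = ∫ p : UnitAddTorus d × UnitAddCircle, ⟪A (p.1 + Pi.single i p.2), B (p.1 + Pi.single i p.2)⟫_ℝ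
          ∂((volume : Measure (UnitAddTorus d)).prod (volume : Measure UnitAddCircle)) := by
        have h := integral_map (μ := (volume : Measure (UnitAddTorus d)).prod (volume : Measure UnitAddCircle))
          hmp.measurable.aemeasurable (f := fun x => ⟪A x, B x⟫_ℝ) (by rw [hmp.map_eq]; exact hABm)
        rw [hmp.map_eq] at h
        exact h
    _ = ∫ p : UnitAddTorus d × UnitAddCircle, ⟪A p.1, B (p.1 + Pi.single i p.2)⟫_ℝ
          ∂((volume : Measure (UnitAddTorus d)).prod (volume : Measure UnitAddCircle)) := by
        simp_rw [hA]
    _ = ∫ x, ∫ s, ⟪A x, B (x + Pi.single i s)⟫_ℝ := integral_prod _ hint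
    _ = ∫ x, ⟪A x, axisAvg i B x⟫_ℝ := by
        refine integral_congr_ae ?_
        filter_upwards [hsec] with x hx
        rw [integral_inner hx, axisAvg_apply]

omit [DecidableEq d] [InnerProductSpace ℝ G] in
/-- Measurability of a field on `T^d` seen on `T^d × UnitAddCircle` through the first projection. [folklore] -/
theorem aestronglyMeasurable_comp_fst_prod {E : Type*} [TopologicalSpace E] {A : UnitAddTorus d → E}
    (hAm : AEStronglyMeasurable A volume) :
    AEStronglyMeasurable (fun p : UnitAddTorus d × UnitAddCircle => A p.1)
      ((volume : Measure (UnitAddTorus d)).prod (volume : Measure UnitAddCircle)) :=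
  hAm.comp_quasiMeasurePreserving
    (Measure.quasiMeasurePreserving_fst (μ := (volume : Measure (UnitAddTorus d)))
      (ν := (volume : Measure UnitAddCircle)))

/-- Integrability provider for `integral_inner_eq_integral_inner_axisAvg`: `A ∈ L¹` and `B`
bounded measurable. [folklore] -/
theorem integrable_inner_shift_of_bound (i : d) {A B : UnitAddTorus d → G}
    (hA : Integrable A volume) (hBm : AEStronglyMeasurable B volume) {C : ℝ} (hC : ∀ x, ‖B x‖ ≤ C) :
    Integrable (fun p : UnitAddTorus d × UnitAddCircle => ⟪A p.1, B (p.1 + Pi.single i p.2)⟫_ℝ)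
      ((volume : Measure (UnitAddTorus d)).prod (volume : Measure UnitAddCircle)) := by
  have hmp := measurePreserving_add_single_prod i
  have hm : AEStronglyMeasurable
      (fun p : UnitAddTorus d × UnitAddCircle => ⟪A p.1, B (p.1 + Pi.single i p.2)⟫_ℝ)
      ((volume : Measure (UnitAddTorus d)).prod (volume : Measure UnitAddCircle)) :=
    (aestronglyMeasurable_comp_fst_prod hA.aestronglyMeasurable).inner (hBm.comp_measurePreserving hmp)
  have hbd : Integrable (fun p : UnitAddTorus d × UnitAddCircle => ‖A p.1‖ * C)
      ((volume : Measure (UnitAddTorus d)).prod (volume : Measure UnitAddCircle)) :=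
    hA.norm.mul_prod (integrable_const C)
  refine hbd.mono' hm (ae_of_all _ fun p => ?_)
  exact (norm_inner_le_norm _ _).trans (mul_le_mul_of_nonneg_left (hC _) (norm_nonneg _))

/-- Integrability provider for `integral_inner_eq_integral_inner_axisAvg`: `A, B ∈ L²`. [folklore] -/
theorem integrable_inner_shift_of_memLp (i : d) {A B : UnitAddTorus d → G}
    (hA : MemLp A 2 volume) (hB : MemLp B 2 volume) :
    Integrable (fun p : UnitAddTorus d × UnitAddCircle => ⟪A p.1, B (p.1 + Pi.single i p.2)⟫_ℝ)
      ((volume : Measure (UnitAddTorus d)).prod (volume : Measure UnitAddCircle)) := by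
  have hmp := measurePreserving_add_single_prod i
  have hm : AEStronglyMeasurable
      (fun p : UnitAddTorus d × UnitAddCircle => ⟪A p.1, B (p.1 + Pi.single i p.2)⟫_ℝ)
      ((volume : Measure (UnitAddTorus d)).prod (volume : Measure UnitAddCircle)) :=
    (aestronglyMeasurable_comp_fst_prod hA.aestronglyMeasurable).inner
      (hB.aestronglyMeasurable.comp_measurePreserving hmp)
  have hA2 : Integrable (fun x => ‖A x‖ ^ 2) volume := hA.integrable_norm_pow two_ne_zero
  have hB2 : Integrable (fun x => ‖B x‖ ^ 2) volume := hB.integrable_norm_pow two_ne_zero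
  have hA2' : Integrable (fun p : UnitAddTorus d × UnitAddCircle => ‖A p.1‖ ^ 2 * (1 : ℝ))
      ((volume : Measure (UnitAddTorus d)).prod (volume : Measure UnitAddCircle)) :=
    hA2.mul_prod (integrable_const (1 : ℝ))
  have hB2' : Integrable (fun p : UnitAddTorus d × UnitAddCircle => ‖B (p.1 + Pi.single i p.2)‖ ^ 2)
      ((volume : Measure (UnitAddTorus d)).prod (volume : Measure UnitAddCircle)) :=
    (hmp.integrable_comp hB2.aestronglyMeasurable).2 hB2
  refine (hA2'.add hB2').mono' hm (ae_of_all _ fun p => ?_)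
  have h1 := norm_inner_le_norm (𝕜 := ℝ) (A p.1) (B (p.1 + Pi.single i p.2))
  have h2 : ‖A p.1‖ * ‖B (p.1 + Pi.single i p.2)‖ ≤
      ‖A p.1‖ ^ 2 * 1 + ‖B (p.1 + Pi.single i p.2)‖ ^ 2 := by
    nlinarith [sq_nonneg (‖A p.1‖ - ‖B (p.1 + Pi.single i p.2)‖), norm_nonneg (A p.1),
      norm_nonneg (B (p.1 + Pi.single i p.2))]
  exact h1.trans h2

end PairingSec

/-! ## `L²` contractivity of the axis average -/

section L2Sec

variable {d : Type*} [Fintype d] [DecidableEq d]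
variable {E : Type*} [NormedAddCommGroup E]

/-- Axis translates have the same `Lᵖ` norm (translation invariance of the volume). [folklore] -/
theorem eLpNorm_comp_add_single (i : d) {W : UnitAddTorus d → E} (hW : AEStronglyMeasurable W volume)
    (s : UnitAddCircle) (p : ℝ≥0∞) :
    eLpNorm (fun x : UnitAddTorus d => W (x + Pi.single i s)) p volume = eLpNorm W p volume := by
  have hmp : MeasurePreserving (fun x : UnitAddTorus d => x + Pi.single i s)
      (volume : Measure (UnitAddTorus d)) (volume : Measure (UnitAddTorus d)) :=
    measurePreserving_add_right (volume : Measure (UnitAddTorus d)) (Pi.single i s : UnitAddTorus d)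
  have h := eLpNorm_comp_measurePreserving (p := p) hW hmp
  exact h

variable [NormedSpace ℝ E]

/-- **Axis averaging does not increase the `L²` norm**: `‖axisAvg i W‖₂ ≤ ‖W‖₂` (Minkowski's
integral inequality, Stein 1970, App. A.1, and `eLpNorm_comp_add_single`). [folklore] -/
theorem eLpNorm_axisAvg_le (i : d) {W : UnitAddTorus d → E} (hW : AEStronglyMeasurable W volume) :
    eLpNorm (axisAvg i W) 2 volume ≤ eLpNorm W 2 volume := by
  set F : UnitAddTorus d → UnitAddCircle → E := fun x s => W (x + Pi.single i s) with hFdef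
  have hF : AEStronglyMeasurable (uncurry F)
      ((volume : Measure (UnitAddTorus d)).prod (volume : Measure UnitAddCircle)) :=
    hW.comp_measurePreserving (measurePreserving_add_single_prod i)
  have h2 : (2 : ℝ≥0∞) ≠ (⊤ : ℝ≥0∞) := ENNReal.ofNat_ne_top
  have h12 : (1 : ℝ≥0∞) ≤ 2 := by norm_num
  have h : eLpNorm (fun x => ∫ s, F x s) 2 volume ≤ ∫⁻ s, eLpNorm (fun x => F x s) 2 volume :=
    eLpNorm_integral_le_lintegral_eLpNorm hF h12 h2
  have hs : ∀ s : UnitAddCircle, eLpNorm (fun x => F x s) 2 volume = eLpNorm W 2 volume := fun s =>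
    eLpNorm_comp_add_single i hW s 2
  have hR : ∫⁻ s, eLpNorm (fun x => F x s) 2 (volume : Measure (UnitAddTorus d)) = eLpNorm W 2 volume := by
    rw [lintegral_congr fun s => hs s, lintegral_const, measure_univ, mul_one]
  rw [hR] at h
  exact h

/-- `L²` fields have `L²` axis averages. [folklore] -/
theorem memLp_axisAvg (i : d) {W : UnitAddTorus d → E} (hW : MemLp W 2 volume) :
    MemLp (axisAvg i W) 2 volume :=
  ⟨aestronglyMeasurable_axisAvg hW.1, (eLpNorm_axisAvg_le i hW.1).trans_lt hW.2⟩

end L2Sec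

/-! ## Planar sections `T² → T³` and descent of fields invariant along the third axis -/

section Three

local notation "𝕋³" => UnitAddTorus (Fin 3)
local notation "𝕋²" => UnitAddTorus (Fin 2)
local notation "E³" => EuclideanSpace ℝ (Fin 3)
local notation "E²" => EuclideanSpace ℝ (Fin 2)

/-- The planar section `T² → T³`, `y ↦ (y₀, y₁, 0)`. [folklore] -/
def planarSect (y : 𝕋²) : 𝕋³ := Fin.snoc (α := fun _ : Fin 3 => UnitAddCircle) y 0

/-- Evaluation lemma for planar sections. [folklore] -/
@[simp]
theorem planarSect_apply_castSucc (y : 𝕋²) (j : Fin 2) : planarSect y (Fin.castSucc j) = y j :=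
  Fin.snoc_castSucc (α := fun _ : Fin 3 => UnitAddCircle) 0 y j

/-- Evaluation lemma for planar sections. [folklore] -/
@[simp]
theorem planarSect_apply_two (y : 𝕋²) : planarSect y 2 = 0 :=
  Fin.snoc_last (α := fun _ : Fin 3 => UnitAddCircle) 0 y

/-- The third coordinate of a planar section vanishes (index `Fin.last 2`). [folklore] -/
theorem planarSect_apply_last (y : 𝕋²) : planarSect y (Fin.last 2) = 0 :=
  planarSect_apply_two y

/-- The planar projection is a left inverse of the planar section. [folklore] -/
@[simp]
theorem planarProj_planarSect (y : 𝕋²) : planarProj (planarSect y) = y := by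
  funext j
  simp

/-- The planar coordinates of `s e₃` vanish. [folklore] -/
theorem single_last_apply_castSucc (s : UnitAddCircle) (j : Fin 2) :
    (Pi.single (Fin.last 2) s : 𝕋³) (Fin.castSucc j) = 0 := by
  rw [Pi.single_apply, if_neg (Fin.castSucc_lt_last j).ne]

/-- The third coordinate of `s e₃` is `s`. [folklore] -/
theorem single_last_apply_last (s : UnitAddCircle) :
    (Pi.single (Fin.last 2) s : 𝕋³) (Fin.last 2) = s := by
  simp

/-- Every point of `T³` is its planar section shifted along the third axis. [folklore] -/
theorem planarSect_planarProj_add_single (x : 𝕋³) :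
    planarSect (planarProj x) + Pi.single (Fin.last 2) (x (Fin.last 2)) = x := by
  funext i
  refine Fin.lastCases ?_ (fun j => ?_) i
  · rw [Pi.add_apply, planarSect_apply_last, single_last_apply_last, zero_add]
  · rw [Pi.add_apply, planarSect_apply_castSucc, single_last_apply_castSucc, add_zero, planarProj_apply]

/-- A field on `T³` invariant under the translations along the third axis is the planar lift of
its planar section. [folklore] -/
theorem eq_comp_planarSect_comp_planarProj {β : Type*} {f : 𝕋³ → β}
    (hf : ∀ (s : UnitAddCircle) (x : 𝕋³), f (x + Pi.single (Fin.last 2) s) = f x) :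
    f = (f ∘ planarSect) ∘ planarProj := by
  funext x
  conv_lhs => rw [← planarSect_planarProj_add_single x]
  rw [hf]
  rfl

/-- The planar section through the covering maps: `σ (proj Z) = proj (Z₀, Z₁, 0)`. [folklore] -/
theorem planarSect_proj (Z : E²) : planarSect (proj Z) = proj (planarEmbed (Z, 0)) := by
  funext i
  refine Fin.lastCases ?_ (fun j => ?_) i
  · rw [planarSect_apply_last, proj_apply, last_two_eq, planarEmbed_apply_two]
    simp
  · rw [planarSect_apply_castSucc, proj_apply, proj_apply, planarEmbed_apply_castSucc]

/-- Lifts of planar sections of functions on `T³`. [folklore] -/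
theorem lift_comp_planarSect {β : Type*} (f : 𝕋³ → β) :
    lift (f ∘ planarSect) = lift f ∘ fun Z : E² => planarEmbed (Z, 0) := by
  funext Z
  simp only [lift_apply, Function.comp_apply, planarSect_proj]

/-- Planar sections of smooth functions are smooth. [folklore] -/
theorem IsSmooth.comp_planarSect {F : Type*} [NormedAddCommGroup F] [NormedSpace ℝ F] {f : 𝕋³ → F}
    (hf : IsSmooth f) : IsSmooth (f ∘ planarSect) := by
  unfold IsSmooth
  rw [lift_comp_planarSect]
  exact hf.comp (planarEmbed.contDiff.comp (contDiff_id.prodMk contDiff_const))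

/-- Space–time lifts of planar sections of space–time fields. [folklore] -/
theorem stLift_comp_planarSect {β : Type*} (ψ : ℝ → 𝕋³ → β) :
    stLift (fun t => ψ t ∘ planarSect) = stLift ψ ∘ fun p : ℝ × E² => (p.1, planarEmbed (p.2, 0)) := by
  funext p
  show ψ p.1 (planarSect (proj p.2)) = ψ p.1 (proj (planarEmbed (p.2, 0)))
  rw [planarSect_proj]

/-- Planar sections of jointly smooth space–time fields are jointly smooth. [folklore] -/
theorem contDiff_stLift_comp_planarSect {F : Type*} [NormedAddCommGroup F] [NormedSpace ℝ F]
    {ψ : ℝ → 𝕋³ → F} {n : WithTop ℕ∞} (hψ : ContDiff ℝ n (stLift ψ)) :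
    ContDiff ℝ n (stLift fun t => ψ t ∘ planarSect) := by
  rw [stLift_comp_planarSect]
  exact hψ.comp (contDiff_fst.prodMk (planarEmbed.contDiff.comp (contDiff_snd.prodMk contDiff_const)))

/-- `planarEmbed` reassembles a vector from its planar part and third coordinate. [folklore] -/
@[simp]
theorem planarEmbed_planarProjE (w : E³) : planarEmbed (planarProjE w, w 2) = w := by
  ext i
  refine Fin.lastCases ?_ (fun j => ?_) i
  · rw [last_two_eq, planarEmbed_apply_two]
  · rw [planarEmbed_apply_castSucc, planarProjE_apply]

/-- An invariant field on `T³` is the `2½`-dimensional field of its planar section. [folklore] -/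
theorem eq_twoHalf_of_forall_add_single {f : 𝕋³ → E³}
    (hf : ∀ (s : UnitAddCircle) (x : 𝕋³), f (x + Pi.single (Fin.last 2) s) = f x) :
    f = twoHalf (fun y => planarProjE (f (planarSect y))) (fun y => f (planarSect y) 2) := by
  conv_lhs => rw [eq_comp_planarSect_comp_planarProj hf]
  funext x
  simp only [twoHalf, Function.comp_apply, planarEmbed_planarProjE]

/-! ## The planar shear `T² × T¹ → T³` -/

/-- The shear `(y, s) ↦ σ(y) + s e₃`, a bijection `T² × T¹ → T³`. [folklore] -/
def planarShear (p : 𝕋² × UnitAddCircle) : 𝕋³ := planarSect p.1 + Pi.single (Fin.last 2) p.2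

/-- The planar coordinates of the planar shear. [folklore] -/
theorem planarShear_apply_castSucc (p : 𝕋² × UnitAddCircle) (j : Fin 2) :
    planarShear p (Fin.castSucc j) = p.1 j := by
  rw [planarShear, Pi.add_apply, planarSect_apply_castSucc, single_last_apply_castSucc, add_zero]

/-- The third coordinate of the planar shear. [folklore] -/
@[simp]
theorem planarShear_apply_last (p : 𝕋² × UnitAddCircle) : planarShear p (Fin.last 2) = p.2 := by
  rw [planarShear, Pi.add_apply, planarSect_apply_last, single_last_apply_last, zero_add]

/-- The planar projection of the planar shear is the first factor. [folklore] -/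
@[simp]
theorem planarProj_planarShear (p : 𝕋² × UnitAddCircle) : planarProj (planarShear p) = p.1 := by
  funext j
  rw [planarProj_apply, planarShear_apply_castSucc]

/-- The planar shear is the inverse of Mathlib's `MeasurableEquiv.piFinSuccAbove` at the last
coordinate, composed with the swap of the factors. [folklore] -/
theorem planarShear_eq_symm_swap (p : 𝕋² × UnitAddCircle) :
    planarShear p =
      (MeasurableEquiv.piFinSuccAbove (fun _ : Fin 3 => UnitAddCircle) (Fin.last 2)).symm (p.2, p.1) := by
  rw [MeasurableEquiv.piFinSuccAbove_symm_apply, Fin.insertNthEquiv_last]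
  funext i
  refine Fin.lastCases ?_ (fun j => ?_) i
  · rw [planarShear_apply_last]
    simp only [Fin.snocEquiv_apply]
    exact (Fin.snoc_last (α := fun _ : Fin 3 => UnitAddCircle) p.2 p.1).symm
  · rw [planarShear_apply_castSucc]
    simp

/-- **The planar shear preserves volume** (`T² × T¹ → T³`; product of the Haar probability
measures versus the Haar probability measure). [folklore] -/
theorem measurePreserving_planarShear :
    MeasurePreserving planarShear ((volume : Measure 𝕋²).prod (volume : Measure UnitAddCircle)) volume := by
  have h1 := (measurePreserving_piFinSuccAbove (fun _ : Fin 3 => (volume : Measure UnitAddCircle))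
    (Fin.last 2)).symm
  have h2 : MeasurePreserving (Prod.swap : 𝕋² × UnitAddCircle → UnitAddCircle × 𝕋²)
      ((volume : Measure 𝕋²).prod (volume : Measure UnitAddCircle))
      ((volume : Measure UnitAddCircle).prod (Measure.pi fun _ : Fin 2 => (volume : Measure UnitAddCircle))) := by
    have := Measure.measurePreserving_swap (μ := (volume : Measure 𝕋²)) (ν := (volume : Measure UnitAddCircle))
    simpa [MeasureTheory.volume_pi] using this
  have h3 := h1.comp h2
  have hfun : ((MeasurableEquiv.piFinSuccAbove (fun _ : Fin 3 => UnitAddCircle) (Fin.last 2)).symm ∘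
      (Prod.swap : 𝕋² × UnitAddCircle → UnitAddCircle × 𝕋²)) = planarShear := by
    funext p
    rw [Function.comp_apply, planarShear_eq_symm_swap]
    rfl
  rw [hfun] at h3
  simpa [MeasureTheory.volume_pi] using h3

/-! ### The planar section of the third-axis average -/

variable {E : Type*} [NormedAddCommGroup E] [NormedSpace ℝ E]

/-- The planar section of the third-axis average is `y ↦ ∫ W(σ y + s e₃) ds`. [folklore] -/
theorem axisAvg_comp_planarSect_apply (W : 𝕋³ → E) (y : 𝕋²) :
    (axisAvg (Fin.last 2) W ∘ planarSect) y = ∫ s, W (planarShear (y, s)) := rfl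

/-- The third-axis average is the planar lift of its planar section (exact invariance). [folklore] -/
theorem axisAvg_last_eq_comp (W : 𝕋³ → E) :
    axisAvg (Fin.last 2) W = (axisAvg (Fin.last 2) W ∘ planarSect) ∘ planarProj :=
  eq_comp_planarSect_comp_planarProj fun s x => axisAvg_add_single (Fin.last 2) W s x

/-- Measurability of the planar section of the third-axis average. [folklore] -/
theorem aestronglyMeasurable_axisAvg_comp_planarSect {W : 𝕋³ → E}
    (hW : AEStronglyMeasurable W volume) :
    AEStronglyMeasurable (axisAvg (Fin.last 2) W ∘ planarSect) (volume : Measure 𝕋²) :=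
  (hW.comp_measurePreserving measurePreserving_planarShear).integral_prod_right'

/-- **`L²` bound for the planar section of the third-axis average**:
`‖(axisAvg e₃ W) ∘ σ‖_{L²(T²)} ≤ ‖W‖_{L²(T³)}` (`eLpNorm_axisAvg_le` and measure preservation of the
planar projection). [folklore] -/
theorem eLpNorm_axisAvg_comp_planarSect_le {W : 𝕋³ → E} (hW : AEStronglyMeasurable W volume) :
    eLpNorm (axisAvg (Fin.last 2) W ∘ planarSect) 2 (volume : Measure 𝕋²) ≤ eLpNorm W 2 volume := by
  have hg := aestronglyMeasurable_axisAvg_comp_planarSect hW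
  have h1 : eLpNorm ((axisAvg (Fin.last 2) W ∘ planarSect) ∘ planarProj) 2 (volume : Measure 𝕋³) =
      eLpNorm (axisAvg (Fin.last 2) W ∘ planarSect) 2 (volume : Measure 𝕋²) :=
    eLpNorm_comp_measurePreserving hg measurePreserving_planarProj
  rw [← h1, ← axisAvg_last_eq_comp]
  exact eLpNorm_axisAvg_le (Fin.last 2) hW

/-- The planar section of the third-axis average of an `L²(T³)` field lies in `L²(T²)`. [folklore] -/
theorem memLp_axisAvg_comp_planarSect {W : 𝕋³ → E} (hW : MemLp W 2 volume) :
    MemLp (axisAvg (Fin.last 2) W ∘ planarSect) 2 (volume : Measure 𝕋²) :=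
  ⟨aestronglyMeasurable_axisAvg_comp_planarSect hW.1,
    (eLpNorm_axisAvg_comp_planarSect_le hW.1).trans_lt hW.2⟩

end Three

end Literature.Analysis.FunctionSpaces.Torus

end
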